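import Summits.QuantumFields.YangMills.Theorems.SwapVirialDeficitGnomonicTaylorLine
import HarnessLib

/-!
# THE `C⁴` BOUNDS OF THE σ-GLUED DEFICIT IN THE AMBIENT NORM OF `GnoCoord L` — `|∂ₛᵏ F̂(η + sξ)| ≤ Cₖ·L⁴·(√3‖ξ‖)ᵏ`
# (free-hands support of ⟨stmt-QuantumFields-24197⟩ `SwapVirialDeficit.SwapGluedStiffness`)

✓`taylor_four_gnoDeficit_line` (K7b) bounds the directional derivatives of `F̂ = gnoDeficit z χ a ε` along `s ↦ η + sξ` by `Cₖ·L⁴·Sᵏ` in terms of the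
EUCLIDEAN letter sizes of the direction (`√Σ(ξ.1.1)ₖ², …, √Σ(ξ.2.2 i)ₖ² ≤ S`).  Consumers that work with a normed fibre (w3 g65's «RAY JETS ⟹ TAYLOR DATUM» glue for
w2 g58's ✓`laplaceMethod_quantitative_fibred_of_taylor`; LEAD g97's W3 split) want the bound in the norm of the ambient space.  `GnoCoord L =
((ℝ³ × ℝ³) × ℝ³ × (Fol L → ℝ³))` carries Mathlib's product ∕ sup norm, and every letter's Euclidean size is `≤ √3·‖ξ‖`:
* `sqrt_sum_sq_le_sqrt_three_mul_norm` (`√Σvᵢ² ≤ √3‖v‖` on `Fin 3 → ℝ`), `letterSizes_le_norm`;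
* ★★★ `taylor_four_gnoDeficit_line_norm` — for hub `a ≠ 0`, EVERY `η ξ : GnoCoord L`, with `ψ s = F̂(η + s • ξ)`: `|ψ′| ≤ 720L⁴(√3‖ξ‖)`, `|ψ″| ≤ 20400L⁴(√3‖ξ‖)²`,
  `|ψ‴| ≤ 2484000L⁴(√3‖ξ‖)³`, `|ψ⁗| ≤ 381240000L⁴(√3‖ξ‖)⁴` everywhere, and the cubic ∕ quartic Taylor data at `s = 0` with the same constants — NO size hypotheses left.

HONEST LABEL: a repackaging in the ambient norm; no estimate on the ring's Gibbs state; nothing about ⟨24197⟩ (window-uniform, OPEN), (LW), (M), W3∕W5–W9 or any rung is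
proved; ⟨24194⟩ ∕ ⟨24196⟩ ∕ ⟨24497⟩ OPEN; item of record ⟨24085⟩ SubOctaveBounded aside ∕ untouched; the Yang–Mills mass gap is NOT proved; no summit is proved by a line.
THEOREMS ONLY (0 `def`, 0 `sorry`), standard axioms, no local instances.  Seat ym-line-fcl-p3 g47 (cell ym-idea-1, free hands), `--supports stmt-QuantumFields-24197`.
References: [cite: Luscher1983, §2]; [folklore].
-/

set_option autoImplicit false
set_option synthInstance.maxSize 1024

noncomputable section

open Quaternion Set
open scoped Quaternion BigOperators
open Literature.MathematicalPhysics.QuantumLattice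
open Literature.MathematicalPhysics.QuantumFieldTheory hiding SU2
open Summit.QuantumFields.YangMills.Theorems.FemtoTransferGap
open Summit.QuantumFields.YangMills.Theorems.FemtoTransferGap.TT
open Summit.QuantumFields.YangMills.Theorems.SwapVirialDeficit.BlowUpRing

namespace Summit.QuantumFields.YangMills.Theorems.SwapVirialDeficit.Gnomonic

variable {L : ℕ} [NeZero L]

omit [NeZero L] in
/-- `√(Σ vᵢ²) ≤ √3·‖v‖` for `v : Fin 3 → ℝ` with the sup norm. [folklore] -/
theorem sqrt_sum_sq_le_sqrt_three_mul_norm (v : Fin 3 → ℝ) : Real.sqrt (∑ i, v i ^ 2) ≤ Real.sqrt 3 * ‖v‖ := by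
  have h : ∀ i, v i ^ 2 ≤ ‖v‖ ^ 2 := fun i => by
    have h1 : |v i| ≤ ‖v‖ := by simpa [Real.norm_eq_abs] using norm_le_pi_norm v i
    rw [← sq_abs]; exact pow_le_pow_left₀ (abs_nonneg _) h1 2
  have hs : ∑ i, v i ^ 2 ≤ 3 * ‖v‖ ^ 2 := by
    calc ∑ i, v i ^ 2 ≤ ∑ _i : Fin 3, ‖v‖ ^ 2 := Finset.sum_le_sum fun i _ => h i
      _ = 3 * ‖v‖ ^ 2 := by simp
  calc Real.sqrt (∑ i, v i ^ 2) ≤ Real.sqrt (3 * ‖v‖ ^ 2) := Real.sqrt_le_sqrt hs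
    _ = Real.sqrt 3 * ‖v‖ := by rw [Real.sqrt_mul (by norm_num), Real.sqrt_sq (norm_nonneg _)]

/-- Every letter of a direction `ξ : GnoCoord L` has Euclidean size `≤ √3·‖ξ‖` (product ∕ sup norm). [folklore] -/
theorem letterSizes_le_norm (ξ : GnoCoord L) :
    Real.sqrt (∑ k, ξ.1.1 k ^ 2) ≤ Real.sqrt 3 * ‖ξ‖ ∧ Real.sqrt (∑ k, ξ.1.2 k ^ 2) ≤ Real.sqrt 3 * ‖ξ‖ ∧ Real.sqrt (∑ k, ξ.2.1 k ^ 2) ≤ Real.sqrt 3 * ‖ξ‖ ∧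
      ∀ i, Real.sqrt (∑ k, ξ.2.2 i k ^ 2) ≤ Real.sqrt 3 * ‖ξ‖ := by
  have h3 : 0 ≤ Real.sqrt 3 := Real.sqrt_nonneg _
  have hx : ‖ξ.1.1‖ ≤ ‖ξ‖ := (norm_fst_le ξ.1).trans (norm_fst_le ξ)
  have hy : ‖ξ.1.2‖ ≤ ‖ξ‖ := (norm_snd_le ξ.1).trans (norm_fst_le ξ)
  have hz : ‖ξ.2.1‖ ≤ ‖ξ‖ := (norm_fst_le ξ.2).trans (norm_snd_le ξ)
  have hf : ∀ i, ‖ξ.2.2 i‖ ≤ ‖ξ‖ := fun i => ((norm_le_pi_norm ξ.2.2 i).trans (norm_snd_le ξ.2)).trans (norm_snd_le ξ)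
  exact ⟨(sqrt_sum_sq_le_sqrt_three_mul_norm _).trans (mul_le_mul_of_nonneg_left hx h3),
    (sqrt_sum_sq_le_sqrt_three_mul_norm _).trans (mul_le_mul_of_nonneg_left hy h3),
    (sqrt_sum_sq_le_sqrt_three_mul_norm _).trans (mul_le_mul_of_nonneg_left hz h3),
    fun i => (sqrt_sum_sq_le_sqrt_three_mul_norm _).trans (mul_le_mul_of_nonneg_left (hf i) h3)⟩

/-- ★★★ **THE σ-GLUED DEFICIT IS `C⁴`-BOUNDED IN THE AMBIENT NORM OF THE GNOMONIC CHART**: for hub `a ≠ 0`, signs `ε`, EVERY base point `η` and direction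
`ξ : GnoCoord L`, with `ψ s = gnoDeficit z χ a ε (η + s • ξ)`: `|ψ′ s| ≤ 720L⁴·(√3‖ξ‖)`, `|ψ″ s| ≤ 20400L⁴·(√3‖ξ‖)²`, `|ψ‴ s| ≤ 2484000L⁴·(√3‖ξ‖)³`,
`|ψ⁗ s| ≤ 381240000L⁴·(√3‖ξ‖)⁴` for all `s`, and `|F̂(η+ξ) − F̂ η − ψ′ 0 − ψ″ 0/2| ≤ 2484000L⁴(√3‖ξ‖)³/2`,
`|F̂(η+ξ) − F̂ η − ψ′ 0 − ψ″ 0/2 − ψ‴ 0/6| ≤ 381240000L⁴(√3‖ξ‖)⁴/6`. [cite: Luscher1983, §2] -/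
theorem taylor_four_gnoDeficit_line_norm (z : Fin 3 → Bool) (χ : Site 3 L → SU2) {a : ℍ} (ha : a ≠ 0) (ε : GnoSign L) (η ξ : GnoCoord L) :
    (∀ s, |deriv (fun s : ℝ => gnoDeficit z χ a ε (η + s • ξ)) s| ≤ 720 * (L : ℝ) ^ 4 * (Real.sqrt 3 * ‖ξ‖) ∧
        |iteratedDeriv 2 (fun s : ℝ => gnoDeficit z χ a ε (η + s • ξ)) s| ≤ 20400 * (L : ℝ) ^ 4 * (Real.sqrt 3 * ‖ξ‖) ^ 2 ∧
        |iteratedDeriv 3 (fun s : ℝ => gnoDeficit z χ a ε (η + s • ξ)) s| ≤ 2484000 * (L : ℝ) ^ 4 * (Real.sqrt 3 * ‖ξ‖) ^ 3 ∧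
        |iteratedDeriv 4 (fun s : ℝ => gnoDeficit z χ a ε (η + s • ξ)) s| ≤ 381240000 * (L : ℝ) ^ 4 * (Real.sqrt 3 * ‖ξ‖) ^ 4) ∧
      |gnoDeficit z χ a ε (η + ξ) - gnoDeficit z χ a ε η - deriv (fun s : ℝ => gnoDeficit z χ a ε (η + s • ξ)) 0 -
          iteratedDeriv 2 (fun s : ℝ => gnoDeficit z χ a ε (η + s • ξ)) 0 / 2| ≤ 2484000 * (L : ℝ) ^ 4 * (Real.sqrt 3 * ‖ξ‖) ^ 3 / 2 ∧
      |gnoDeficit z χ a ε (η + ξ) - gnoDeficit z χ a ε η - deriv (fun s : ℝ => gnoDeficit z χ a ε (η + s • ξ)) 0 -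
          iteratedDeriv 2 (fun s : ℝ => gnoDeficit z χ a ε (η + s • ξ)) 0 / 2 - iteratedDeriv 3 (fun s : ℝ => gnoDeficit z χ a ε (η + s • ξ)) 0 / 6| ≤
        381240000 * (L : ℝ) ^ 4 * (Real.sqrt 3 * ‖ξ‖) ^ 4 / 6 := by
  obtain ⟨hx, hy, hz, hf⟩ := letterSizes_le_norm ξ
  exact taylor_four_gnoDeficit_line z χ ha ε η ξ (by positivity) hx hy hz hf

end Summit.QuantumFields.YangMills.Theorems.SwapVirialDeficit.Gnomonic

end
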